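import Mathlib
import Literature.NumberTheory.Transcendental.ZagierDilogarithmConjecture
import HarnessLib

/-!
# Signed permutations of a combination under a Galois twist make it self-similar

Stub `stub_signedPermutation` of the line `kummer-clausen-linearisation` (reshape c2,
"Galois descent") for the crux `ZagierDilogarithmConjecture` (stmt-KontsevichZagierPeriods-10550,
route `HyperbolicBloch`).

Write `C := AddSubgroup.closure dilogRelators ⊆ ℤ[ℂ]` (`FreeAbelianGroup ℂ`) and
`ℚ̄ := algebraicClosure ℚ ℂ`. For a combination `β = Σ nᵢ[zᵢ]` put `β̄ := Σ nᵢ[z̄ᵢ]`,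
`ξ := β − β̄ = Σ nᵢ([zᵢ] − [z̄ᵢ])`, and for a `ℚ`-embedding `σ : ℚ̄ → ℂ` together with lifts
`wᵢ, w'ᵢ ∈ ℚ̄` of `zᵢ, z̄ᵢ` put `S₁ := Σ nᵢ[σwᵢ]`, `S₂ := Σ nᵢ[σw'ᵢ]`, `σ_*ξ := S₁ − S₂`. The
combination is *self-similar at `σ`* if there are integers `a ≠ 0`, `b` with `a•σ_*ξ − b•ξ ∈ C`.

**The signed-permutation case** (`stub_signedPermutation`): suppose that each of the two families
`(σwᵢ)ᵢ` and `(σw'ᵢ)ᵢ` is either (all real), or a permutation `π` of `(zᵢ)ᵢ` with `n ∘ π = n`, or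
a permutation `π` of `(z̄ᵢ)ᵢ` with `n ∘ π = n`. Then the combination is self-similar at `σ`, with
`a = 2`.

Proof: the `zᵢ = wᵢ` are algebraic, so `P := β + β̄ = Σ nᵢ([zᵢ] + [z̄ᵢ]) ∈ C` (relators
`[w] + [w̄]`). For each family one finds `e ∈ {0, 1, −1}` with `S − e•β ∈ C`: in the real case
`e = 0` (`S ∈ C`, relators `[w]`, `w` real); in the `+π` case `e = 1` (`S = β` by reindexing);
in the `−π` case `e = −1` (`S = β̄` by reindexing, and `β̄ + β = P ∈ C`). With such `e₁, e₂` for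
`S₁, S₂` the identity
`2•(S₁ − S₂) − (e₁ − e₂)•(β − β̄) = 2•(S₁ − e₁•β) − 2•(S₂ − e₂•β) + (e₁ − e₂)•(β + β̄)`
exhibits `2•σ_*ξ − (e₁ − e₂)•ξ` as a member of `C`.

Sources: Neumann 1998 §2 (the relator group: five-term elements, `[w] + [w̄]`, real `[w]`);
Zagier 2007 Ch. I §§3–4. The computation itself is elementary [folklore].
Not here: which field-theoretic data produce the signed-permutation hypothesis (one complex
place, cyclotomic points) and the propagation of `Σ nᵢ D(zᵢ) = 0` from self-similarity
(`stub_selfSimilar`) — separate stubs of the line.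
-/

noncomputable section

open scoped BigOperators ComplexConjugate
open Literature.NumberTheory.Transcendental

namespace Summit.KontsevichZagierPeriods.HyperbolicBloch.ZagierDilogarithmGaloisDescent

/-- The `ℤ`-linear identity behind the signed-permutation case: in any additive commutative group,
`2•(S₁ − S₂) − (e₁ − e₂)•(β − β') = 2•(S₁ − e₁•β) − 2•(S₂ − e₂•β) + (e₁ − e₂)•(β + β')`.
[folklore] -/
theorem signedPerm_two_zsmul_sub_sub_zsmul_sub {G : Type*} [AddCommGroup G] (S₁ S₂ β β' : G)
    (e₁ e₂ : ℤ) :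
    (2 : ℤ) • (S₁ - S₂) - (e₁ - e₂) • (β - β') =
      (2 : ℤ) • (S₁ - e₁ • β) - (2 : ℤ) • (S₂ - e₂ • β) + (e₁ - e₂) • (β + β') := by
  module

/-- For algebraic `zᵢ`, the element `β + β̄ = Σ nᵢ[zᵢ] + Σ nᵢ[z̄ᵢ]` lies in the relator group
`⟨dilogRelators⟩` (it is `Σ nᵢ([zᵢ] + [z̄ᵢ])`, a combination of the relators `[w] + [w̄]`).
[folklore] -/
theorem signedPerm_sum_add_sum_conj_mem_closure {k : ℕ} (z : Fin k → ℂ) (n : Fin k → ℤ)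
    (hz : ∀ i, IsAlgebraic ℚ (z i)) :
    (∑ i, n i • FreeAbelianGroup.of (z i)) + (∑ i, n i • FreeAbelianGroup.of (conj (z i))) ∈
      AddSubgroup.closure dilogRelators := by
  rw [← Finset.sum_add_distrib]
  refine AddSubgroup.sum_mem _ fun i _ => ?_
  rw [← zsmul_add]
  exact AddSubgroup.zsmul_mem _
    (AddSubgroup.subset_closure (of_add_of_conj_mem_dilogRelators (hz i))) _

/-- One family of the signed-permutation case: if `(uᵢ)ᵢ` is all real, or a permutation `π` of
`(zᵢ)ᵢ` with `n ∘ π = n`, or a permutation `π` of `(z̄ᵢ)ᵢ` with `n ∘ π = n` (`zᵢ` algebraic), then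
`Σ nᵢ[uᵢ] − e • Σ nᵢ[zᵢ] ∈ ⟨dilogRelators⟩` for some integer `e` (namely `e = 0, 1, −1`
respectively: `Σ nᵢ[uᵢ]` is a sum of real relators, or equals `β = Σ nᵢ[zᵢ]` by reindexing, or
equals `β̄` by reindexing with `β̄ + β` a sum of relators `[w] + [w̄]`). [folklore] -/
theorem signedPerm_exists_sum_sub_zsmul_mem_closure {k : ℕ} (z u : Fin k → ℂ) (n : Fin k → ℤ)
    (hz : ∀ i, IsAlgebraic ℚ (z i))
    (hu : (∀ i, (u i).im = 0) ∨
      (∃ π : Equiv.Perm (Fin k), (∀ i, n (π i) = n i) ∧ ∀ i, u i = z (π i)) ∨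
      (∃ π : Equiv.Perm (Fin k), (∀ i, n (π i) = n i) ∧ ∀ i, u i = conj (z (π i)))) :
    ∃ e : ℤ, (∑ i, n i • FreeAbelianGroup.of (u i)) - e • (∑ i, n i • FreeAbelianGroup.of (z i)) ∈
      AddSubgroup.closure dilogRelators := by
  rcases hu with hreal | ⟨π, hπ, hπu⟩ | ⟨π, hπ, hπu⟩
  · -- all `uᵢ` real: `Σ nᵢ[uᵢ] ∈ C`, take `e = 0`
    refine ⟨0, ?_⟩
    rw [zero_zsmul, sub_zero]
    exact AddSubgroup.sum_mem _ fun i _ =>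
      AddSubgroup.zsmul_mem _ (AddSubgroup.subset_closure (of_real_mem_dilogRelators (hreal i))) _
  · -- `uᵢ = z_{π i}`: `Σ nᵢ[uᵢ] = β`, take `e = 1`
    refine ⟨1, ?_⟩
    have hS : ∑ i, n i • FreeAbelianGroup.of (u i) = ∑ i, n i • FreeAbelianGroup.of (z i) := by
      simp only [hπu]
      exact Fintype.sum_equiv π _ _ fun i => by rw [hπ i]
    rw [hS, one_zsmul, sub_self]
    exact zero_mem _
  · -- `uᵢ = z̄_{π i}`: `Σ nᵢ[uᵢ] = β̄`, take `e = −1` and use `β̄ + β ∈ C`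
    refine ⟨-1, ?_⟩
    have hS : ∑ i, n i • FreeAbelianGroup.of (u i) =
        ∑ i, n i • FreeAbelianGroup.of (conj (z i)) := by
      simp only [hπu]
      exact Fintype.sum_equiv π _ _ fun i => by rw [hπ i]
    rw [hS, neg_one_zsmul, sub_neg_eq_add, add_comm]
    exact signedPerm_sum_add_sum_conj_mem_closure z n hz

/-- **Signed permutations under a Galois twist ⇒ self-similarity.** Let `zᵢ ∈ ℂ`, `nᵢ ∈ ℤ`,
`σ : ℚ̄ → ℂ` a `ℚ`-embedding (`ℚ̄ = algebraicClosure ℚ ℂ`) and `wᵢ, w'ᵢ ∈ ℚ̄` lifts of `zᵢ, z̄ᵢ`.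
Suppose (for all such data) that each of the families `(σwᵢ)ᵢ`, `(σw'ᵢ)ᵢ` is all real, or a
permutation `π` of `(zᵢ)ᵢ` with `n ∘ π = n`, or a permutation `π` of `(z̄ᵢ)ᵢ` with `n ∘ π = n`.
Then there are `a ≠ 0`, `b ∈ ℤ` (namely `a = 2`, `b = e₁ − e₂` with `eⱼ ∈ {0, ±1}`) with
`a•σ_*ξ − b•ξ ∈ ⟨dilogRelators⟩`, where `ξ = Σ nᵢ([zᵢ] − [z̄ᵢ])` and
`σ_*ξ = Σ nᵢ([σwᵢ] − [σw'ᵢ])`: with `S₁ = Σ nᵢ[σwᵢ]`, `S₂ = Σ nᵢ[σw'ᵢ]`, `β = Σ nᵢ[zᵢ]`,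
`β̄ = Σ nᵢ[z̄ᵢ]` one has `Sⱼ − eⱼ•β ∈ C` and `β + β̄ ∈ C`, and
`2•(S₁ − S₂) − (e₁ − e₂)•(β − β̄) = 2•(S₁ − e₁•β) − 2•(S₂ − e₂•β) + (e₁ − e₂)•(β + β̄)`.
[folklore] -/
theorem stub_signedPermutation :
    ∀ (k : ℕ) (z : Fin k → ℂ) (n : Fin k → ℤ),
      (∀ (σ : ↥(algebraicClosure ℚ ℂ) →ₐ[ℚ] ℂ) (w w' : Fin k → ↥(algebraicClosure ℚ ℂ)),
          (∀ i, (w i : ℂ) = z i) → (∀ i, (w' i : ℂ) = conj (z i)) →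
          ((∀ i, (σ (w i)).im = 0) ∨
            (∃ π : Equiv.Perm (Fin k), (∀ i, n (π i) = n i) ∧ ∀ i, σ (w i) = z (π i)) ∨
            (∃ π : Equiv.Perm (Fin k), (∀ i, n (π i) = n i) ∧ ∀ i, σ (w i) = conj (z (π i)))) ∧
          ((∀ i, (σ (w' i)).im = 0) ∨
            (∃ π : Equiv.Perm (Fin k), (∀ i, n (π i) = n i) ∧ ∀ i, σ (w' i) = z (π i)) ∨
            (∃ π : Equiv.Perm (Fin k), (∀ i, n (π i) = n i) ∧ ∀ i, σ (w' i) = conj (z (π i))))) →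
        ∀ (σ : ↥(algebraicClosure ℚ ℂ) →ₐ[ℚ] ℂ) (w w' : Fin k → ↥(algebraicClosure ℚ ℂ)),
          (∀ i, (w i : ℂ) = z i) → (∀ i, (w' i : ℂ) = conj (z i)) →
          ∃ a b : ℤ, a ≠ 0 ∧
            a • (∑ i, n i • (FreeAbelianGroup.of (σ (w i)) - FreeAbelianGroup.of (σ (w' i)))) -
              b • (∑ i, n i • (FreeAbelianGroup.of (z i) - FreeAbelianGroup.of (conj (z i)))) ∈
                AddSubgroup.closure dilogRelators := by
  intro k z n hcase σ w w' hw hw'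
  obtain ⟨h₁, h₂⟩ := hcase σ w w' hw hw'
  -- the `zᵢ = wᵢ ∈ ℚ̄` are algebraic
  have hz : ∀ i, IsAlgebraic ℚ (z i) := fun i => hw i ▸ mem_algebraicClosure_iff.1 (w i).2
  -- `Sⱼ − eⱼ•β ∈ C` for the two families, and `β + β̄ ∈ C`
  obtain ⟨e₁, he₁⟩ := signedPerm_exists_sum_sub_zsmul_mem_closure z (fun i => σ (w i)) n hz h₁
  obtain ⟨e₂, he₂⟩ := signedPerm_exists_sum_sub_zsmul_mem_closure z (fun i => σ (w' i)) n hz h₂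
  have hP := signedPerm_sum_add_sum_conj_mem_closure z n hz
  refine ⟨2, e₁ - e₂, two_ne_zero, ?_⟩
  have hξσ : ∑ i, n i • (FreeAbelianGroup.of (σ (w i)) - FreeAbelianGroup.of (σ (w' i))) =
      (∑ i, n i • FreeAbelianGroup.of (σ (w i))) - ∑ i, n i • FreeAbelianGroup.of (σ (w' i)) := by
    simp only [zsmul_sub, Finset.sum_sub_distrib]
  have hξ : ∑ i, n i • (FreeAbelianGroup.of (z i) - FreeAbelianGroup.of (conj (z i))) =
      (∑ i, n i • FreeAbelianGroup.of (z i)) - ∑ i, n i • FreeAbelianGroup.of (conj (z i)) := by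
    simp only [zsmul_sub, Finset.sum_sub_distrib]
  rw [hξσ, hξ, signedPerm_two_zsmul_sub_sub_zsmul_sub _ _ _ _ e₁ e₂]
  exact add_mem (sub_mem (AddSubgroup.zsmul_mem _ he₁ _) (AddSubgroup.zsmul_mem _ he₂ _))
    (AddSubgroup.zsmul_mem _ hP _)

end Summit.KontsevichZagierPeriods.HyperbolicBloch.ZagierDilogarithmGaloisDescent

end
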